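import Mathlib.Data.Nat.Bitwise

/-!
# ω-census, the pattern `(2,2,2)⁴`: the kernel mask engine (search skeleton data types, linear clause forms, homomorphic code arithmetic)

HONEST FRAMING (pub-omega census; verbatim): lottery ticket; floor = certified bounds/negative ranges.
Census STRUCTURE bookkeeping (question Q7, row `k = 4`: a KERNEL second leg for the lower half `n₄ ≥ 56` on the one cell,
`(ℤ/2)⁵`, that no second census engine reaches), not progress on `ω`.

Group-independent engine behind the kernel theorem «`(ℤ/2)⁵` admits NO four simultaneous-TPP triples of 2-subsets» (CKSU 2005
Def. 5.1, tree form `IsSTPP`, `N = 4`, all twelve sets of cardinality 2) — a `K = 4` clone of the `(2,2,2)³` engine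
`STPP222CubeEngine.lean` (ENG2 gen 18) with ONE change of arithmetic.  Soundness = `STPP222TetraReflect.lean`.

* NORMAL FORM (membership form): `A t = {0, a t}` (`t = 0..3`), `B 0 = {0, b₀}`, `C 0 = {0, c₀}`, `B t = {q t, q' t}`,
  `C t = {r t, r' t}` (`t = 1,2,3`) — 18 unknown entries (`V18`), assigned in the fixed order
  `a₀ b₀ c₀ | q₁ r₁ q'₁ r'₁ a₁ | q₂ r₂ q'₂ r'₂ a₂ | q₃ r₃ q'₃ r'₃ a₃` (positions 0–17; positions 0–2 = the START triple).
* CLAUSES as LINEAR FORMS (`LinCl`, data `K0 … K17` here, in `STPP222TetraClausesA/B.lean` and `STPP222TetraSearch.lean`;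
  3 028 forms, of which the 1 143 of positions 0–12 are exactly the `(2,2,2)³` forms): a Def-5.1 clause whose last
  entry in the order is the entry `v` of position `p` reads `w₀ ± v`, `w₀ = Σ plus − Σ minus` over earlier entries; the
  FORBIDDEN value of `v` is `∓w₀`.  The correspondence index tuple ↔ linear form is decided in the reflection files
  (`linValid`), nothing here is trusted.
* CODES and ARITHMETIC (`ArithH`, HOMOMORPHIC): an encoding supplies `add`/`neg` ON CODES (`EncH` in `STPP222TetraIdx.lean`);
  for an elementary abelian `2`-group the codes are bit vectors `0 … 2^r − 1`, `add = Nat.xor` (kernel GMP), `neg = id`,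
  so every mask is an `r`-bit… `2^r`-bit natural number (the `(2,2,2)³` engine's slot-padded sum representation would need
  `≈ 2²¹`-bit masks on `(ℤ/2)⁵`).  All recursions are recursor applications (no `brecOn`).
* MASK SEARCH (`searchB4`, `STPP222TetraSearch.lean`): at position `p` the forbidden MASK is the `ℕ` whose bit `x` is set for
  every forbidden code `x` of `K p` (plus normalisation / ordering exclusions); the search descends into every code of `el`
  whose bit is clear; `true` = every branch below every start of the list is refuted.

References: H. Cohn, R. Kleinberg, B. Szegedy, C. Umans, FOCS 2005 (arXiv:math/0511460), Def. 5.1.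
Record: pub-omega HOME `pub-omega-eng2-g23/tetra/` (ENG2 gen 23, 2026-08-26): generators `k4gen.py` (clause lists; levels 0–12 are
literally the `(2,2,2)³` words), `search4.py` (Python mirror of this engine, node-for-node equal to the C census engine cfind v1.2
run WITHOUT symmetry flags on `(ℤ/2)⁵`: 48 024 nodes / 4 115 340 clause evaluations, INFEASIBLE), `gen5.py` (the `GL₅(𝔽₂)` cover maps).
-/

namespace Summit.MatrixMultiplication.OmegaCensus

namespace STPP222TetraNeg

/-! ## 1. Entries, configurations, linear clause forms -/

/-- The 18 unknown entries, in search order. -/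
inductive V18 where
  | a0 | b0 | c0 | q1 | r1 | q1' | r1' | a1 | q2 | r2 | q2' | r2' | a2 | q3 | r3 | q3' | r3' | a3
  deriving DecidableEq, Repr

/-- A (partial) `(2,2,2)⁴` configuration in normal form, over `ℕ`-codes: the 18 unknown entries (unassigned entries
hold `0`, the code of `0`, and are never read by the clauses of their own or earlier positions). -/
structure Cfg4 where
  /-- `A 0 = {0, a₀}` -/ a0 : ℕ
  /-- `B 0 = {0, b₀}` -/ b0 : ℕ
  /-- `C 0 = {0, c₀}` -/ c0 : ℕ
  /-- first element of `B 1` -/ q1 : ℕ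
  /-- first element of `C 1` -/ r1 : ℕ
  /-- second element of `B 1` -/ q1' : ℕ
  /-- second element of `C 1` -/ r1' : ℕ
  /-- `A 1 = {0, a₁}` -/ a1 : ℕ
  /-- first element of `B 2` -/ q2 : ℕ
  /-- first element of `C 2` -/ r2 : ℕ
  /-- second element of `B 2` -/ q2' : ℕ
  /-- second element of `C 2` -/ r2' : ℕ
  /-- `A 2 = {0, a₂}` -/ a2 : ℕ
  /-- first element of `B 3` -/ q3 : ℕ
  /-- first element of `C 3` -/ r3 : ℕ
  /-- second element of `B 3` -/ q3' : ℕ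
  /-- second element of `C 3` -/ r3' : ℕ
  /-- `A 3 = {0, a₃}` -/ a3 : ℕ

/-- Entry of a configuration by variable (recursor form, one kernel step). -/
noncomputable def Cfg4.get (P : Cfg4) (v : V18) : ℕ :=
  @V18.rec (fun _ => ℕ) P.a0 P.b0 P.c0 P.q1 P.r1 P.q1' P.r1' P.a1 P.q2 P.r2 P.q2' P.r2' P.a2 P.q3 P.r3 P.q3' P.r3'
    P.a3 v

/-- Setting the entry of a variable. -/
def Cfg4.set (P : Cfg4) : V18 → ℕ → Cfg4
  | .a0, x => { P with a0 := x }
  | .b0, x => { P with b0 := x }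
  | .c0, x => { P with c0 := x }
  | .q1, x => { P with q1 := x }
  | .r1, x => { P with r1 := x }
  | .q1', x => { P with q1' := x }
  | .r1', x => { P with r1' := x }
  | .a1, x => { P with a1 := x }
  | .q2, x => { P with q2 := x }
  | .r2, x => { P with r2 := x }
  | .q2', x => { P with q2' := x }
  | .r2', x => { P with r2' := x }
  | .a2, x => { P with a2 := x }
  | .q3, x => { P with q3 := x }
  | .r3, x => { P with r3 := x }
  | .q3', x => { P with q3' := x }
  | .r3', x => { P with r3' := x }
  | .a3, x => { P with a3 := x }

/-- The LINEAR FORM of a clause at its position: the earlier entries occurring with `+` and with `−` in its formal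
word (fixed zero entries dropped, the position's own entry `v` removed — its sign is `pos`: the word is `w₀ + v` if
`pos`, `w₀ − v` otherwise, `w₀ = Σ plus − Σ minus`). -/
structure LinCl where
  /-- sign of the position's entry -/ pos : Bool
  /-- earlier entries with coefficient `+1` -/ plus : List V18
  /-- earlier entries with coefficient `−1` -/ minus : List V18
  deriving DecidableEq, Repr

/-! ## 2. Code arithmetic (homomorphic encodings) -/

/-- HOMOMORPHIC code arithmetic of a group encoding (instances: `STPP222TetraClauses.lean`, `EncH`): `add` computes
the code of a sum from the two codes, `neg` the code of the negative.  (The `(2,2,2)³` engine `STPP222CubeEngine`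
forms signed sums in `ℕ` and reduces once; here every step stays a code, which keeps the masks of an elementary
abelian `2`-group inside one machine word: codes `0 … 2^r − 1`, `add = Nat.xor`.) -/
structure ArithH where
  /-- code of the sum -/ add : ℕ → ℕ → ℕ
  /-- code of the negative -/ neg : ℕ → ℕ

/-- The arithmetic of an elementary abelian `2`-group on bit-vector codes: sum = `Nat.xor`, negation = identity. -/
def xorArith : ArithH := ⟨Nat.xor, fun c => c⟩

/-- Code of `g + Σ (entries of the listed variables)` from the code `init` of `g` (recursor form). -/
noncomputable def sumGet (A : ArithH) (P : Cfg4) (l : List V18) (init : ℕ) : ℕ :=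
  @List.rec V18 (fun _ => ℕ → ℕ) (fun acc => acc) (fun v _ ih acc => ih (A.add acc (P.get v))) l init

/-- The code of `w₀ = Σ plus − Σ minus` of a linear form on a configuration. -/
noncomputable def wCode (A : ArithH) (P : Cfg4) (l : LinCl) : ℕ :=
  A.add (sumGet A P l.plus 0) (A.neg (sumGet A P l.minus 0))

/-- The code FORBIDDEN by a linear form for the entry of its position: `neg w₀` if `pos`, `w₀` else. -/
noncomputable def linForb (A : ArithH) (P : Cfg4) (l : LinCl) : ℕ :=
  @Bool.rec (fun _ => ℕ) (wCode A P l) (A.neg (wCode A P l)) l.pos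

/-- The forbidden MASK of a linear-form list on top of `m₀`: bit `linForb l` set for every `l` (recursor form). -/
noncomputable def linMask (A : ArithH) (P : Cfg4) (K : List LinCl) (m₀ : ℕ) : ℕ :=
  @List.rec LinCl (fun _ => ℕ → ℕ) (fun m => m) (fun l _ ih m => ih (Nat.lor m (Nat.shiftLeft 1 (linForb A P l))))
    K m₀

/-- The mask of all bits `< k`. -/
def lowMask (k : ℕ) : ℕ := Nat.shiftLeft 1 k - 1


/-- Linear forms of the 1 clauses of position 0 (`a0`). -/
def K0 : List LinCl :=
  [⟨true, [], []⟩]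

/-- Linear forms of the 3 clauses of position 1 (`b0`). -/
def K1 : List LinCl :=
  [⟨true, [], []⟩, ⟨true, [.a0], []⟩, ⟨false, [.a0], []⟩]

/-- Linear forms of the 9 clauses of position 2 (`c0`). -/
def K2 : List LinCl :=
  [⟨true, [], []⟩, ⟨true, [.b0], []⟩, ⟨false, [.b0], []⟩, ⟨true, [.a0], []⟩, ⟨false, [.a0], []⟩,
    ⟨true, [.a0, .b0], []⟩, ⟨false, [.a0, .b0], []⟩, ⟨true, [.a0], [.b0]⟩, ⟨false, [.a0], [.b0]⟩]

/-- Linear forms of the 12 clauses of position 3 (`q1`). -/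
def K3 : List LinCl :=
  [⟨true, [], []⟩, ⟨true, [], [.b0]⟩, ⟨true, [.a0], []⟩, ⟨true, [.a0], [.b0]⟩, ⟨false, [.c0], []⟩,
    ⟨false, [], [.c0]⟩, ⟨false, [.b0, .c0], []⟩, ⟨false, [.b0], [.c0]⟩, ⟨false, [.c0], [.a0]⟩,
    ⟨false, [], [.a0, .c0]⟩, ⟨false, [.b0, .c0], [.a0]⟩, ⟨false, [.b0], [.a0, .c0]⟩]

/-- Linear forms of the 24 clauses of position 4 (`r1`). -/
def K4 : List LinCl :=
  [⟨true, [], []⟩, ⟨true, [], [.c0]⟩, ⟨true, [.b0], []⟩, ⟨true, [.b0], [.c0]⟩, ⟨true, [], [.b0]⟩,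
    ⟨true, [], [.b0, .c0]⟩, ⟨true, [.a0], []⟩, ⟨true, [.a0], [.c0]⟩, ⟨true, [.a0, .b0], []⟩,
    ⟨true, [.a0, .b0], [.c0]⟩, ⟨true, [.a0], [.b0]⟩, ⟨true, [.a0], [.b0, .c0]⟩, ⟨false, [.q1], []⟩,
    ⟨false, [.c0, .q1], []⟩, ⟨false, [.q1], [.b0]⟩, ⟨false, [.c0, .q1], [.b0]⟩, ⟨false, [.a0, .q1], []⟩,
    ⟨false, [.a0, .c0, .q1], []⟩, ⟨false, [.a0, .q1], [.b0]⟩, ⟨false, [.a0, .c0, .q1], [.b0]⟩,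
    ⟨false, [.q1], [.a0]⟩, ⟨false, [.c0, .q1], [.a0]⟩, ⟨false, [.q1], [.a0, .b0]⟩, ⟨false, [.c0, .q1], [.a0, .b0]⟩]

/-- Linear forms of the 33 clauses of position 5 (`Q1`). -/
def K5 : List LinCl :=
  [⟨true, [], [.r1]⟩, ⟨true, [.c0], [.r1]⟩, ⟨true, [], [.b0, .r1]⟩, ⟨true, [.c0], [.b0, .r1]⟩,
    ⟨true, [.a0], [.r1]⟩, ⟨true, [.a0, .c0], [.r1]⟩, ⟨true, [.a0], [.b0, .r1]⟩, ⟨true, [.a0, .c0], [.b0, .r1]⟩,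
    ⟨true, [], [.a0, .r1]⟩, ⟨true, [.c0], [.a0, .r1]⟩, ⟨true, [], [.a0, .b0, .r1]⟩, ⟨true, [.c0], [.a0, .b0, .r1]⟩,
    ⟨true, [], []⟩, ⟨true, [], [.b0]⟩, ⟨true, [.a0], []⟩, ⟨true, [.a0], [.b0]⟩, ⟨false, [.c0], []⟩,
    ⟨false, [], [.c0]⟩, ⟨false, [.b0, .c0], []⟩, ⟨false, [.b0], [.c0]⟩, ⟨false, [.c0], [.a0]⟩,
    ⟨false, [], [.a0, .c0]⟩, ⟨false, [.b0, .c0], [.a0]⟩, ⟨false, [.b0], [.a0, .c0]⟩, ⟨true, [], [.q1, .r1]⟩,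
    ⟨true, [.c0], [.q1, .r1]⟩, ⟨false, [.q1], [.r1]⟩, ⟨false, [.c0, .q1], [.r1]⟩, ⟨true, [], [.a0, .q1, .r1]⟩,
    ⟨true, [.c0], [.a0, .q1, .r1]⟩, ⟨false, [.q1], [.a0, .r1]⟩, ⟨false, [.c0, .q1], [.a0, .r1]⟩, ⟨true, [], [.q1]⟩]

/-- Linear forms of the 63 clauses of position 6 (`R1`). -/
def K6 : List LinCl :=
  [⟨true, [], []⟩, ⟨true, [], [.c0]⟩, ⟨true, [.b0], []⟩, ⟨true, [.b0], [.c0]⟩, ⟨true, [], [.b0]⟩,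
    ⟨true, [], [.b0, .c0]⟩, ⟨true, [.a0], []⟩, ⟨true, [.a0], [.c0]⟩, ⟨true, [.a0, .b0], []⟩,
    ⟨true, [.a0, .b0], [.c0]⟩, ⟨true, [.a0], [.b0]⟩, ⟨true, [.a0], [.b0, .c0]⟩, ⟨false, [.q1], []⟩,
    ⟨false, [.c0, .q1], []⟩, ⟨false, [.q1'], []⟩, ⟨false, [.c0, .q1'], []⟩, ⟨false, [.q1], [.b0]⟩,
    ⟨false, [.c0, .q1], [.b0]⟩, ⟨false, [.q1'], [.b0]⟩, ⟨false, [.c0, .q1'], [.b0]⟩, ⟨false, [.a0, .q1], []⟩,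
    ⟨false, [.a0, .c0, .q1], []⟩, ⟨false, [.a0, .q1'], []⟩, ⟨false, [.a0, .c0, .q1'], []⟩,
    ⟨false, [.a0, .q1], [.b0]⟩, ⟨false, [.a0, .c0, .q1], [.b0]⟩, ⟨false, [.a0, .q1'], [.b0]⟩,
    ⟨false, [.a0, .c0, .q1'], [.b0]⟩, ⟨false, [.q1], [.a0]⟩, ⟨false, [.c0, .q1], [.a0]⟩, ⟨false, [.q1'], [.a0]⟩,
    ⟨false, [.c0, .q1'], [.a0]⟩, ⟨false, [.q1], [.a0, .b0]⟩, ⟨false, [.c0, .q1], [.a0, .b0]⟩,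
    ⟨false, [.q1'], [.a0, .b0]⟩, ⟨false, [.c0, .q1'], [.a0, .b0]⟩, ⟨true, [.q1], [.r1]⟩, ⟨false, [.q1, .r1], []⟩,
    ⟨true, [.q1'], [.r1]⟩, ⟨false, [.r1, .q1'], []⟩, ⟨true, [.q1], [.b0, .r1]⟩, ⟨false, [.q1, .r1], [.b0]⟩,
    ⟨true, [.q1'], [.b0, .r1]⟩, ⟨false, [.r1, .q1'], [.b0]⟩, ⟨true, [.a0, .q1], [.r1]⟩,
    ⟨false, [.a0, .q1, .r1], []⟩, ⟨true, [.a0, .q1'], [.r1]⟩, ⟨false, [.a0, .r1, .q1'], []⟩,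
    ⟨true, [.a0, .q1], [.b0, .r1]⟩, ⟨false, [.a0, .q1, .r1], [.b0]⟩, ⟨true, [.a0, .q1'], [.b0, .r1]⟩,
    ⟨false, [.a0, .r1, .q1'], [.b0]⟩, ⟨false, [.q1'], [.q1]⟩, ⟨false, [.c0, .q1'], [.q1]⟩, ⟨false, [.q1], [.q1']⟩,
    ⟨false, [.c0, .q1], [.q1']⟩, ⟨false, [.q1'], [.a0, .q1]⟩, ⟨false, [.c0, .q1'], [.a0, .q1]⟩,
    ⟨false, [.q1], [.a0, .q1']⟩, ⟨false, [.c0, .q1], [.a0, .q1']⟩, ⟨true, [], [.r1]⟩, ⟨true, [.q1'], [.q1, .r1]⟩,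
    ⟨false, [.r1, .q1'], [.q1]⟩]

/-- Linear forms of the 121 clauses of position 7 (`a1`). -/
def K7 : List LinCl :=
  [⟨false, [.r1], []⟩, ⟨false, [.r1'], []⟩, ⟨false, [.r1], [.c0]⟩, ⟨false, [.r1'], [.c0]⟩, ⟨false, [.b0, .r1], []⟩,
    ⟨false, [.b0, .r1'], []⟩, ⟨false, [.b0, .r1], [.c0]⟩, ⟨false, [.b0, .r1'], [.c0]⟩, ⟨false, [.r1], [.b0]⟩,
    ⟨false, [.r1'], [.b0]⟩, ⟨false, [.r1], [.b0, .c0]⟩, ⟨false, [.r1'], [.b0, .c0]⟩, ⟨false, [.a0, .r1], []⟩,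
    ⟨false, [.a0, .r1'], []⟩, ⟨false, [.a0, .r1], [.c0]⟩, ⟨false, [.a0, .r1'], [.c0]⟩,
    ⟨false, [.a0, .b0, .r1], []⟩, ⟨false, [.a0, .b0, .r1'], []⟩, ⟨false, [.a0, .b0, .r1], [.c0]⟩,
    ⟨false, [.a0, .b0, .r1'], [.c0]⟩, ⟨false, [.a0, .r1], [.b0]⟩, ⟨false, [.a0, .r1'], [.b0]⟩,
    ⟨false, [.a0, .r1], [.b0, .c0]⟩, ⟨false, [.a0, .r1'], [.b0, .c0]⟩, ⟨false, [.q1], []⟩,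
    ⟨false, [.q1, .r1'], [.r1]⟩, ⟨false, [.q1, .r1], [.r1']⟩, ⟨false, [.q1'], []⟩, ⟨false, [.q1', .r1'], [.r1]⟩,
    ⟨false, [.r1, .q1'], [.r1']⟩, ⟨false, [.q1], [.b0]⟩, ⟨false, [.q1, .r1'], [.b0, .r1]⟩,
    ⟨false, [.q1, .r1], [.b0, .r1']⟩, ⟨false, [.q1'], [.b0]⟩, ⟨false, [.q1', .r1'], [.b0, .r1]⟩,
    ⟨false, [.r1, .q1'], [.b0, .r1']⟩, ⟨false, [.a0, .q1], []⟩, ⟨false, [.a0, .q1, .r1'], [.r1]⟩,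
    ⟨false, [.a0, .q1, .r1], [.r1']⟩, ⟨false, [.a0, .q1'], []⟩, ⟨false, [.a0, .q1', .r1'], [.r1]⟩,
    ⟨false, [.a0, .r1, .q1'], [.r1']⟩, ⟨false, [.a0, .q1], [.b0]⟩, ⟨false, [.a0, .q1, .r1'], [.b0, .r1]⟩,
    ⟨false, [.a0, .q1, .r1], [.b0, .r1']⟩, ⟨false, [.a0, .q1'], [.b0]⟩, ⟨false, [.a0, .q1', .r1'], [.b0, .r1]⟩,
    ⟨false, [.a0, .r1, .q1'], [.b0, .r1']⟩, ⟨true, [.c0], [.q1]⟩, ⟨true, [], [.c0, .q1]⟩,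
    ⟨true, [.b0, .c0], [.q1]⟩, ⟨true, [.b0], [.c0, .q1]⟩, ⟨true, [.c0], [.q1']⟩, ⟨true, [], [.c0, .q1']⟩,
    ⟨true, [.b0, .c0], [.q1']⟩, ⟨true, [.b0], [.c0, .q1']⟩, ⟨true, [.c0], [.a0, .q1]⟩, ⟨true, [], [.a0, .c0, .q1]⟩,
    ⟨true, [.b0, .c0], [.a0, .q1]⟩, ⟨true, [.b0], [.a0, .c0, .q1]⟩, ⟨true, [.c0], [.a0, .q1']⟩,
    ⟨true, [], [.a0, .c0, .q1']⟩, ⟨true, [.b0, .c0], [.a0, .q1']⟩, ⟨true, [.b0], [.a0, .c0, .q1']⟩,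
    ⟨true, [.r1], [.q1]⟩, ⟨true, [.r1'], [.q1]⟩, ⟨true, [.r1], [.c0, .q1]⟩, ⟨true, [.r1'], [.c0, .q1]⟩,
    ⟨true, [.b0, .r1], [.q1]⟩, ⟨true, [.b0, .r1'], [.q1]⟩, ⟨true, [.b0, .r1], [.c0, .q1]⟩,
    ⟨true, [.b0, .r1'], [.c0, .q1]⟩, ⟨true, [.r1], [.q1']⟩, ⟨true, [.r1'], [.q1']⟩, ⟨true, [.r1], [.c0, .q1']⟩,
    ⟨true, [.r1'], [.c0, .q1']⟩, ⟨true, [.b0, .r1], [.q1']⟩, ⟨true, [.b0, .r1'], [.q1']⟩,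
    ⟨true, [.b0, .r1], [.c0, .q1']⟩, ⟨true, [.b0, .r1'], [.c0, .q1']⟩, ⟨false, [.r1], [.q1]⟩,
    ⟨false, [.r1'], [.q1]⟩, ⟨false, [.r1], [.c0, .q1]⟩, ⟨false, [.r1'], [.c0, .q1]⟩, ⟨false, [.b0, .r1], [.q1]⟩,
    ⟨false, [.b0, .r1'], [.q1]⟩, ⟨false, [.b0, .r1], [.c0, .q1]⟩, ⟨false, [.b0, .r1'], [.c0, .q1]⟩,
    ⟨false, [.r1], [.q1']⟩, ⟨false, [.r1'], [.q1']⟩, ⟨false, [.r1], [.c0, .q1']⟩, ⟨false, [.r1'], [.c0, .q1']⟩,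
    ⟨false, [.b0, .r1], [.q1']⟩, ⟨false, [.b0, .r1'], [.q1']⟩, ⟨false, [.b0, .r1], [.c0, .q1']⟩,
    ⟨false, [.b0, .r1'], [.c0, .q1']⟩, ⟨true, [.q1'], [.q1, .r1]⟩, ⟨true, [.c0, .q1'], [.q1, .r1]⟩,
    ⟨true, [.q1'], [.q1, .r1']⟩, ⟨true, [.c0, .q1'], [.q1, .r1']⟩, ⟨true, [.q1], [.r1, .q1']⟩,
    ⟨true, [.c0, .q1], [.r1, .q1']⟩, ⟨true, [.q1], [.q1', .r1']⟩, ⟨true, [.c0, .q1], [.q1', .r1']⟩,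
    ⟨true, [.q1'], [.a0, .q1, .r1]⟩, ⟨true, [.c0, .q1'], [.a0, .q1, .r1]⟩, ⟨true, [.q1'], [.a0, .q1, .r1']⟩,
    ⟨true, [.c0, .q1'], [.a0, .q1, .r1']⟩, ⟨true, [.q1], [.a0, .r1, .q1']⟩, ⟨true, [.c0, .q1], [.a0, .r1, .q1']⟩,
    ⟨true, [.q1], [.a0, .q1', .r1']⟩, ⟨true, [.c0, .q1], [.a0, .q1', .r1']⟩, ⟨true, [], []⟩, ⟨true, [.r1'], [.r1]⟩,
    ⟨true, [.r1], [.r1']⟩, ⟨true, [.q1'], [.q1]⟩, ⟨true, [.q1', .r1'], [.q1, .r1]⟩,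
    ⟨true, [.r1, .q1'], [.q1, .r1']⟩, ⟨true, [.q1], [.q1']⟩, ⟨true, [.q1, .r1'], [.r1, .q1']⟩,
    ⟨true, [.q1, .r1], [.q1', .r1']⟩]

/-- Linear forms of the 56 clauses of position 8 (`q2`). -/
def K8 : List LinCl :=
  [⟨true, [], []⟩, ⟨true, [], [.b0]⟩, ⟨true, [.a0], []⟩, ⟨true, [.a0], [.b0]⟩, ⟨true, [], [.q1]⟩,
    ⟨true, [], [.q1']⟩, ⟨true, [.a1], [.q1]⟩, ⟨true, [.a1], [.q1']⟩, ⟨false, [.c0], []⟩, ⟨false, [], [.c0]⟩,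
    ⟨false, [.b0, .c0], []⟩, ⟨false, [.b0], [.c0]⟩, ⟨false, [.c0], [.a0]⟩, ⟨false, [], [.a0, .c0]⟩,
    ⟨false, [.b0, .c0], [.a0]⟩, ⟨false, [.b0], [.a0, .c0]⟩, ⟨false, [.r1], []⟩, ⟨false, [.r1'], []⟩,
    ⟨false, [.r1], [.c0]⟩, ⟨false, [.r1'], [.c0]⟩, ⟨false, [.b0, .r1], []⟩, ⟨false, [.b0, .r1'], []⟩,
    ⟨false, [.b0, .r1], [.c0]⟩, ⟨false, [.b0, .r1'], [.c0]⟩, ⟨false, [.r1], [.a1]⟩, ⟨false, [.r1'], [.a1]⟩,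
    ⟨false, [.r1], [.c0, .a1]⟩, ⟨false, [.r1'], [.c0, .a1]⟩, ⟨false, [.b0, .r1], [.a1]⟩,
    ⟨false, [.b0, .r1'], [.a1]⟩, ⟨false, [.b0, .r1], [.c0, .a1]⟩, ⟨false, [.b0, .r1'], [.c0, .a1]⟩,
    ⟨false, [.q1], [.r1]⟩, ⟨false, [.c0, .q1], [.r1]⟩, ⟨false, [.q1], [.r1']⟩, ⟨false, [.c0, .q1], [.r1']⟩,
    ⟨false, [.q1'], [.r1]⟩, ⟨false, [.c0, .q1'], [.r1]⟩, ⟨false, [.q1'], [.r1']⟩, ⟨false, [.c0, .q1'], [.r1']⟩,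
    ⟨false, [.q1], [.a0, .r1]⟩, ⟨false, [.c0, .q1], [.a0, .r1]⟩, ⟨false, [.q1], [.a0, .r1']⟩,
    ⟨false, [.c0, .q1], [.a0, .r1']⟩, ⟨false, [.q1'], [.a0, .r1]⟩, ⟨false, [.c0, .q1'], [.a0, .r1]⟩,
    ⟨false, [.q1'], [.a0, .r1']⟩, ⟨false, [.c0, .q1'], [.a0, .r1']⟩, ⟨false, [.q1, .r1'], [.r1]⟩,
    ⟨false, [.q1, .r1], [.r1']⟩, ⟨false, [.q1', .r1'], [.r1]⟩, ⟨false, [.r1, .q1'], [.r1']⟩,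
    ⟨false, [.q1, .r1'], [.r1, .a1]⟩, ⟨false, [.q1, .r1], [.r1', .a1]⟩, ⟨false, [.q1', .r1'], [.r1, .a1]⟩,
    ⟨false, [.r1, .q1'], [.r1', .a1]⟩]

end STPP222TetraNeg

end Summit.MatrixMultiplication.OmegaCensus
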